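import Summits.QuantumAdvantage.AdviceFreeQNC0.AffBells26MoveSystems
import Summits.QuantumAdvantage.AdviceFreeQNC0.AffBells26CubeIdentity
import HarnessLib

/-!
# Q1-gen of the flip-cube sieve: `AffBells26.CubeIdentityGen` (the MOVE-AGNOSTIC cube identity) PROVED (planner qn-p1 g26, ROUND-25 §5.2/§5.10)

Prover seat qn-prover-3 g14 (ask P-26b addendum 2).  **`cubeIdentityGen : CubeIdentityGen`** — for every affine bell strategy `(β, c)` and
every MOVE SYSTEM `(x, F, O)` with `m ≥ 2` moves (`AffBells26.MoveSystem`: move `j` flips the active bit set `F j` and toggles the activity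
of exactly the rows `O j`; all these sets pairwise disjoint):
`Σ_{S ⊆ [m]} #{active firing bells of x_S} ≡ Σ_{g ∈ SurvF} (1 + [form β (base g) g = c_g + DF_g]) (mod 2)`.

Proof = the proof of `cubeIdentity` verbatim, row by row.  `form_xF`: the forms move additively,
`form β x_S g = form β x g + Σ_{j ∈ S} dF_g(j)` (`form_flipAt` + disjointness of the `F j`).  A row `g` is owned by at most one move
(`owners_cases`); by the activity axiom it is active at `x_S` iff `kline x g ⊕ [owner ∈ S]`.  Hence its count over the cube is a
subset-sum count `AffBells24.nSub` over the moves NOT owning it, taken from its base point (`x`, or `x` with the owning move applied):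
even if `g` is blind to one of those moves (`AffBells24.card_filter_test_even`), `≡ 1 + [form (base g) g = c_g + DF_g]` if it sees them all
(`AffBells24.nSub_mod_two`); rows never active contribute nothing.

WHAT THIS IS NOT: `CubeTargetGen`, `CreationsMoveSystem` and the density block are NOT proved here; instrument for the (NP₀) rung of crux
stmt-QuantumAdvantage-22907 (route DWalkThree); separation NOT moved.
-/

namespace Summit.QuantumAdvantage.AdviceFreeQNC0

namespace AffBells26

open Finset Literature.Computability.QuantumComplexity Literature.Computability.QuantumComplexity.RingHLF
open AffBells23 AffBells24 Fib19

variable {N m : ℕ}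

/-! ### Forms along a move cube -/

/-- **Additivity of the forms along a move cube**: `form β x_S g = form β x g + Σ_{j ∈ S} dF_g(j)`. -/
theorem form_xF (β : Fin N → Fin N → ZMod 3) {x : Fin N → Bool} {F O : Fin m → Finset (Fin N)} (hMS : MoveSystem x F O)
    (S : Finset (Fin m)) (g : Fin N) : form β (xF x F S) g = form β x g + ∑ j ∈ S, dF β x F g j := by
  classical
  unfold xF dF
  rw [form_flipAt, sum_biUnion]
  intro j _ j' _ hne
  exact (hMS.2.2.1 j j' hne).1

/-! ### Owners -/

/-- A row is owned by no move or by exactly one. -/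
theorem owners_cases {x : Fin N → Bool} {F O : Fin m → Finset (Fin N)} (hMS : MoveSystem x F O) (g : Fin N) :
    (∀ j, g ∉ O j) ∨ ∃ j₀, g ∈ O j₀ ∧ ∀ j, j ≠ j₀ → g ∉ O j := by
  by_cases h : ∃ j₀, g ∈ O j₀
  · obtain ⟨j₀, hj₀⟩ := h
    refine Or.inr ⟨j₀, hj₀, fun j hne hj => ?_⟩
    exact disjoint_left.1 (hMS.2.2.1 j j₀ hne).2 hj hj₀
  · push Not at h
    exact Or.inl h

/-- The owner set of an unowned row. -/
theorem owners_eq_empty {O : Fin m → Finset (Fin N)} {g : Fin N} (h : ∀ j, g ∉ O j) : owners O g = ∅ := by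
  unfold owners
  rw [filter_eq_empty_iff]
  exact fun j _ => h j

/-- The owner set of a row owned by `j₀`. -/
theorem owners_eq_singleton {O : Fin m → Finset (Fin N)} {g : Fin N} {j₀ : Fin m} (hj₀ : g ∈ O j₀)
    (huniq : ∀ j, j ≠ j₀ → g ∉ O j) : owners O g = {j₀} := by
  unfold owners
  rw [eq_singleton_iff_unique_mem]
  refine ⟨by rw [mem_filter]; exact ⟨mem_univ _, hj₀⟩, fun j hj => ?_⟩
  rw [mem_filter] at hj
  by_contra hne
  exact huniq j hne hj.2

/-! ### Activity along the cube -/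

/-- Unowned rows keep their activity. -/
theorem active_unowned {x : Fin N → Bool} {F O : Fin m → Finset (Fin N)} (hMS : MoveSystem x F O) {g : Fin N}
    (h : ∀ j, g ∉ O j) (S : Finset (Fin m)) : kline (xF x F S) g = kline x g := by
  rw [(hMS.2.1 S).2 g]
  have : ¬ ∃ j ∈ S, g ∈ O j := fun ⟨j, _, hj⟩ => h j hj
  rw [decide_eq_false this, Bool.xor_false]

/-- A row owned by `j₀` has its activity toggled exactly by `j₀`. -/
theorem active_owned {x : Fin N → Bool} {F O : Fin m → Finset (Fin N)} (hMS : MoveSystem x F O) {g : Fin N} {j₀ : Fin m}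
    (hj₀ : g ∈ O j₀) (huniq : ∀ j, j ≠ j₀ → g ∉ O j) (S : Finset (Fin m)) :
    kline (xF x F S) g = xor (kline x g) (decide (j₀ ∈ S)) := by
  rw [(hMS.2.1 S).2 g]
  congr 1
  by_cases hS : j₀ ∈ S
  · rw [decide_eq_true hS, decide_eq_true ⟨j₀, hS, hj₀⟩]
  · rw [decide_eq_false hS, decide_eq_false]
    rintro ⟨j, hj, hgj⟩
    by_cases hne : j = j₀
    · subst hne; exact hS hj
    · exact huniq j hne hgj

/-! ### Counting over the cube -/

/-- Subsets not containing `j₀`: `#{S : j₀ ∉ S ∧ P S} = #{S ⊆ [m] ∖ j₀ : P S}`. -/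
theorem card_filter_not_mem (j₀ : Fin m) (P : Finset (Fin m) → Prop) [DecidablePred P] :
    ((univ : Finset (Finset (Fin m))).filter fun S => j₀ ∉ S ∧ P S).card =
      ((univ.erase j₀).powerset.filter P).card := by
  congr 1
  ext S
  rw [mem_filter, mem_filter, mem_powerset, subset_erase]
  simp

/-- Subsets containing `j₀`: `#{S : j₀ ∈ S ∧ P S} = #{S ⊆ [m] ∖ j₀ : P (insert j₀ S)}`. -/
theorem card_filter_mem (j₀ : Fin m) (P : Finset (Fin m) → Prop) [DecidablePred P] :
    ((univ : Finset (Finset (Fin m))).filter fun S => j₀ ∈ S ∧ P S).card =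
      ((univ.erase j₀).powerset.filter fun S => P (insert j₀ S)).card := by
  refine card_bij (fun S _ => S.erase j₀) (fun S hS => ?_) (fun S hS T hT h => ?_) (fun S hS => ?_)
  · rw [mem_filter] at hS
    rw [mem_filter, mem_powerset, insert_erase hS.2.1]
    exact ⟨erase_subset_erase j₀ (subset_univ S), hS.2.2⟩
  · rw [mem_filter] at hS hT
    rw [← insert_erase hS.2.1, ← insert_erase hT.2.1, h]
  · rw [mem_filter, mem_powerset, subset_erase] at hS
    refine ⟨insert j₀ S, ?_, by rw [erase_insert hS.1.2]⟩
    rw [mem_filter]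
    exact ⟨mem_univ _, mem_insert_self _ _, hS.2⟩

/-- All subsets: `#{S : P S} = #{S ⊆ [m] : P S}`. -/
theorem card_filter_univ_powerset (P : Finset (Fin m) → Prop) [DecidablePred P] :
    ((univ : Finset (Finset (Fin m))).filter P).card = ((univ : Finset (Fin m)).powerset.filter P).card := by
  rw [powerset_univ]

/-! ### The parity of a subset-sum count -/

/-- Parity of a subset-sum count `nSub T γ t` against the survivor summand: even if `γ` vanishes somewhere on `T`, else
`≡ 1 + [s = c + Σ_T γ]` where `t = c − s`. -/
theorem nSub_parity (T : Finset (Fin m)) (hT : T.Nonempty) (γ : Fin m → ZMod 3) (cg s : ZMod 3) :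
    nSub T γ (cg - s) % 2 =
      (if (∀ j ∈ T, γ j ≠ 0) then (1 + if s = cg + ∑ j ∈ T, γ j then 1 else 0) else 0) % 2 := by
  by_cases hsee : ∀ j ∈ T, γ j ≠ 0
  · rw [if_pos hsee, nSub_mod_two T hT γ hsee (cg - s)]
    by_cases h : s = cg + ∑ j ∈ T, γ j
    · rw [if_pos h, if_neg (by rw [h]; intro hh; apply hh; ring)]
    · rw [if_neg h, if_pos]
      intro hh
      apply h
      linear_combination -hh
  · rw [if_neg hsee]
    push Not at hsee
    obtain ⟨j, hj, hγj⟩ := hsee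
    rw [← card_filter_test_eq]
    exact card_filter_test_even γ (cg - s) hj hγj

/-! ### Q1-gen -/

/-- **Q1-gen, `CubeIdentityGen`**: the move-agnostic cube identity. -/
theorem cubeIdentityGen : CubeIdentityGen := by
  classical
  intro N m hN hm β c x F O hMS
  -- row count
  set Ng : Fin N → ℕ := fun g => ((univ : Finset (Finset (Fin m))).filter fun S =>
    kline (xF x F S) g = true ∧ form β (xF x F S) g = c g).card with hNg
  have hswap : (∑ S : Finset (Fin m), activeOnes (xF x F S) (affBell β c (xF x F S))) = ∑ g : Fin N, Ng g := by
    have e : ∀ S : Finset (Fin m), activeOnes (xF x F S) (affBell β c (xF x F S)) =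
        (univ.filter fun g : Fin N => kline (xF x F S) g = true ∧ form β (xF x F S) g = c g).card := by
      intro S
      unfold activeOnes affBell
      congr 1
      refine filter_congr fun g _ => ?_
      rw [decide_eq_true_eq]
      rfl
    simp_rw [e, hNg, card_filter]
    rw [sum_comm]
  rw [hswap]
  -- per-row parity
  have hE : ∀ j₀ : Fin m, ((univ : Finset (Fin m)).erase j₀).Nonempty := by
    intro j₀
    rw [← card_pos, card_erase_of_mem (mem_univ _), card_univ, Fintype.card_fin]
    omega
  have hrow : ∀ g : Fin N, Ng g % 2 =
      (if g ∈ SurvF β x F O then (1 + if form β (base x F O g) g = c g + DF β x F O g then 1 else 0) else 0) % 2 := by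
    intro g
    rcases owners_cases hMS g with hun | ⟨j₀, hj₀, huniq⟩
    · -- unowned row
      have hown := owners_eq_empty hun
      have hfilt : (univ.filter fun j : Fin m => g ∉ O j) = univ := filter_true_of_mem fun j _ => hun j
      by_cases hact : kline x g = true
      · -- always active: count over all subsets
        have hN : Ng g = nSub (univ : Finset (Fin m)) (fun j => dF β x F g j) (c g - form β x g) := by
          rw [hNg]
          simp only
          unfold nSub
          rw [← powerset_univ]
          congr 1
          refine filter_congr fun S _ => ?_
          rw [active_unowned hMS hun S, form_xF β hMS S g]
          constructor
          · rintro ⟨-, h⟩; rw [← h]; ring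
          · intro h; exact ⟨hact, by rw [h]; ring⟩
        have hS : g ∈ SurvF β x F O ↔ ∀ j ∈ (univ : Finset (Fin m)), dF β x F g j ≠ 0 := by
          unfold SurvF
          rw [mem_filter]
          simp only [mem_univ, true_and, forall_true_left]
          exact ⟨fun h j => h.2 j (hun j), fun h => ⟨Or.inl hact, fun j _ => h j⟩⟩
        have hbase : base x F O g = x := by unfold base; rw [if_pos hact]
        have hDF : DF β x F O g = ∑ j ∈ (univ : Finset (Fin m)), dF β x F g j := by unfold DF; rw [hfilt]
        rw [hN, nSub_parity univ ⟨⟨0, by omega⟩, mem_univ _⟩ _ (c g) (form β x g), hbase, hDF]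
        by_cases h1 : ∀ j ∈ (univ : Finset (Fin m)), dF β x F g j ≠ 0
        · rw [if_pos h1, if_pos (hS.2 h1)]
        · rw [if_neg h1, if_neg (fun h => h1 (hS.1 h))]
      · -- never active
        have hN : Ng g = 0 := by
          rw [hNg]
          simp only
          rw [card_eq_zero, filter_eq_empty_iff]
          intro S _ h
          rw [active_unowned hMS hun S] at h
          exact hact h.1
        have hS : g ∉ SurvF β x F O := by
          unfold SurvF
          rw [mem_filter, hown]
          rintro ⟨-, h | h, -⟩
          · exact hact h
          · exact Finset.not_nonempty_empty h
        rw [hN, if_neg hS]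
    · -- row owned by j₀
      have hown := owners_eq_singleton hj₀ huniq
      have hfilt : (univ.filter fun j : Fin m => g ∉ O j) = univ.erase j₀ := by
        ext j
        rw [mem_filter, mem_erase]
        simp only [mem_univ, true_and, and_true]
        constructor
        · intro h hj; subst hj; exact h hj₀
        · intro h; exact huniq j h
      have hS : g ∈ SurvF β x F O ↔ ∀ j ∈ (univ : Finset (Fin m)).erase j₀, dF β x F g j ≠ 0 := by
        unfold SurvF
        rw [mem_filter, hown]
        simp only [mem_univ, true_and, mem_erase, and_true]
        constructor
        · intro h j hj; exact h.2 j (huniq j hj)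
        · intro h; refine ⟨Or.inr ⟨j₀, mem_singleton_self _⟩, fun j hj => h j ?_⟩
          rintro rfl; exact hj hj₀
      have hDF : DF β x F O g = ∑ j ∈ (univ : Finset (Fin m)).erase j₀, dF β x F g j := by unfold DF; rw [hfilt]
      by_cases hact : kline x g = true
      · -- active iff j₀ ∉ S; base = x
        have hbase : base x F O g = x := by unfold base; rw [if_pos hact]
        have hN : Ng g = nSub ((univ : Finset (Fin m)).erase j₀) (fun j => dF β x F g j) (c g - form β x g) := by
          rw [hNg]
          simp only
          unfold nSub
          rw [← card_filter_not_mem j₀]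
          congr 1
          refine filter_congr fun S _ => ?_
          rw [active_owned hMS hj₀ huniq S, hact, form_xF β hMS S g]
          constructor
          · rintro ⟨h1, h2⟩
            refine ⟨fun hS => ?_, by rw [← h2]; ring⟩
            rw [decide_eq_true hS] at h1; exact Bool.noConfusion h1
          · rintro ⟨h1, h2⟩
            exact ⟨by rw [decide_eq_false h1]; rfl, by rw [h2]; ring⟩
        rw [hN, nSub_parity _ (hE j₀) _ (c g) (form β x g), hbase, hDF]
        by_cases h1 : ∀ j ∈ (univ : Finset (Fin m)).erase j₀, dF β x F g j ≠ 0
        · rw [if_pos h1, if_pos (hS.2 h1)]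
        · rw [if_neg h1, if_neg (fun h => h1 (hS.1 h))]
      · -- active iff j₀ ∈ S; base = x with move j₀ applied
        have hbase : base x F O g = xF x F {j₀} := by unfold base; rw [if_neg hact, hown]
        have hfb : form β (base x F O g) g = form β x g + dF β x F g j₀ := by
          rw [hbase, form_xF β hMS {j₀} g, sum_singleton]
        have hact' : kline x g = false := by
          cases h : kline x g
          · rfl
          · exact absurd h hact
        have hN : Ng g = nSub ((univ : Finset (Fin m)).erase j₀) (fun j => dF β x F g j)
            (c g - (form β x g + dF β x F g j₀)) := by
          rw [hNg]
          simp only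
          have step1 : ((univ : Finset (Finset (Fin m))).filter fun S =>
              kline (xF x F S) g = true ∧ form β (xF x F S) g = c g) =
              univ.filter fun S => j₀ ∈ S ∧ (∑ j ∈ S, dF β x F g j) = c g - form β x g := by
            refine filter_congr fun S _ => ?_
            rw [active_owned hMS hj₀ huniq S, hact', form_xF β hMS S g]
            constructor
            · rintro ⟨h1, h2⟩
              have hS : j₀ ∈ S := by
                by_contra hS; rw [decide_eq_false hS] at h1; exact Bool.noConfusion h1
              exact ⟨hS, by rw [← h2]; ring⟩
            · rintro ⟨h1, h2⟩
              exact ⟨by rw [decide_eq_true h1]; rfl, by rw [h2]; ring⟩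
          rw [step1, card_filter_mem j₀ (fun S => (∑ j ∈ S, dF β x F g j) = c g - form β x g)]
          unfold nSub
          congr 1
          refine filter_congr fun S hS => ?_
          rw [mem_powerset, subset_erase] at hS
          rw [sum_insert hS.2]
          constructor
          · intro h; linear_combination h
          · intro h; linear_combination h
        rw [hN, nSub_parity _ (hE j₀) _ (c g) (form β x g + dF β x F g j₀), hfb, hDF]
        by_cases h1 : ∀ j ∈ (univ : Finset (Fin m)).erase j₀, dF β x F g j ≠ 0
        · rw [if_pos h1, if_pos (hS.2 h1)]
        · rw [if_neg h1, if_neg (fun h => h1 (hS.1 h))]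
  -- assemble
  rw [Finset.sum_nat_mod, sum_congr rfl fun g _ => hrow g, ← Finset.sum_nat_mod, sum_ite, sum_const_zero, add_zero]
  unfold survSumF
  congr 1
  apply sum_congr _ fun _ _ => rfl
  ext g
  simp

end AffBells26

end Summit.QuantumAdvantage.AdviceFreeQNC0
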